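import Literature.Computability.ImplicitComplexity.STAConfluence
import Mathlib.Logic.Function.Iterate
import HarnessLib

/-!
# The leftmost-outermost β-step and clocked normalisation

Support file for the `PTIME` soundness half of `STACapturesP` (GMR08 Thm. 3.5: "every
β-reduction step can be carried out on a Turing machine in a number of steps polynomial in the
size of the term, [so] we have the soundness with respect to PTIME"). The deciding machine of
that proof iterates ONE deterministic reduction step a polynomial number of times; this file
fixes the step on the term side (the machine side, on codes, is elsewhere):

* `Term.hasRedex`, `Term.loStep` — the leftmost-outermost β-step (identity on terms without
  β-redex; sums are inert);
* `Term.red_loStep` — it is a `→βγ` step when a redex exists; `Term.loStep_of_hasRedex_false`;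
  `Term.isNormal_iff_hasRedex_false` — on sum-free terms, "no β-redex" is normality;
* `Term.loStep_clocked` — **clocked normalisation**: if every reduction sequence from a sum-free
  `M` has length `≤ W` (the conclusion of `polystep_program`), then for `T > W` the iterate
  `loStep^[T] M` is a normal form of `M`; with `reduces_zero_iff_of_normal` the answer
  `M →* 0` can be read off it (`Term.reduces_zero_iff_loStep_clocked`).

## References

* [GaboardiMarionRonchidellarocca2008] GMR08, Thm. 3.5 and Def. 3.8.
* H. Barendregt, The Lambda Calculus, North-Holland 1984, §13.2 (leftmost reduction is
  normalising; here only the trivial clocked form for strongly normalising terms is used).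
-/

namespace Literature.Computability.ImplicitComplexity

namespace STA

namespace Term

/-- `M` contains a β-redex (sums count as inert binary nodes). [folklore] -/
def hasRedex : Term → Bool
  | .var _ => false
  | .lam M => hasRedex M
  | .app (.lam _) _ => true
  | .app (.var _) N => hasRedex N
  | .app (.app M₁ M₂) N => hasRedex (.app M₁ M₂) || hasRedex N
  | .app (.sum M₁ M₂) N => hasRedex (.sum M₁ M₂) || hasRedex N
  | .sum M N => hasRedex M || hasRedex N

/-- **The leftmost-outermost β-step**: contract the β-redex whose abstraction comes first in
prefix order; identity if there is none. [folklore] -/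
def loStep : Term → Term
  | .var i => .var i
  | .lam M => .lam (loStep M)
  | .app (.lam P) N => P.subst0 N
  | .app (.var i) N => .app (.var i) (loStep N)
  | .app (.app M₁ M₂) N =>
      if hasRedex (.app M₁ M₂) then .app (loStep (.app M₁ M₂)) N else .app (.app M₁ M₂) (loStep N)
  | .app (.sum M₁ M₂) N =>
      if hasRedex (.sum M₁ M₂) then .app (loStep (.sum M₁ M₂)) N else .app (.sum M₁ M₂) (loStep N)
  | .sum M N => if hasRedex M then .sum (loStep M) N else .sum M (loStep N)

/-- Without a redex the step is the identity. [folklore] -/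
theorem loStep_of_hasRedex_false : ∀ {M : Term}, M.hasRedex = false → M.loStep = M
  | .var _, _ => rfl
  | .lam M, h => by
    simp only [hasRedex] at h
    simp [loStep, loStep_of_hasRedex_false h]
  | .app (.lam _) _, h => by simp [hasRedex] at h
  | .app (.var i) N, h => by
    simp only [hasRedex] at h
    simp [loStep, loStep_of_hasRedex_false h]
  | .app (.app M₁ M₂) N, h => by
    simp only [hasRedex, Bool.or_eq_false_iff] at h
    simp [loStep, h.1, loStep_of_hasRedex_false h.2]
  | .app (.sum M₁ M₂) N, h => by
    simp only [hasRedex, Bool.or_eq_false_iff] at h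
    rw [loStep, if_neg (by rw [hasRedex]; simp [h.1]), loStep_of_hasRedex_false h.2]
  | .sum M N, h => by
    simp only [hasRedex, Bool.or_eq_false_iff] at h
    simp [loStep, h.1, loStep_of_hasRedex_false h.2]

/-- **With a redex the step is a `→βγ` step.** [folklore] -/
theorem red_loStep : ∀ {M : Term}, M.hasRedex = true → Red M M.loStep
  | .var _, h => by simp [hasRedex] at h
  | .lam M, h => by
    simp only [hasRedex] at h
    exact Red.lam (red_loStep h)
  | .app (.lam P) N, _ => Red.beta P N
  | .app (.var i) N, h => by
    simp only [hasRedex] at h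
    exact Red.appR _ (red_loStep h)
  | .app (.app M₁ M₂) N, h => by
    by_cases h1 : hasRedex (.app M₁ M₂) = true
    · rw [loStep, if_pos h1]
      exact Red.appL _ (red_loStep h1)
    · rw [loStep, if_neg h1]
      simp only [hasRedex, Bool.or_eq_true] at h h1
      have h2 : hasRedex N = true := by
        rcases h with h | h
        · exact absurd (by simpa [hasRedex] using h) h1
        · exact h
      exact Red.appR _ (red_loStep h2)
  | .app (.sum M₁ M₂) N, h => by
    by_cases h1 : hasRedex (.sum M₁ M₂) = true
    · rw [loStep, if_pos h1]
      exact Red.appL _ (red_loStep h1)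
    · rw [loStep, if_neg h1]
      simp only [hasRedex, Bool.or_eq_true] at h h1
      have h2 : hasRedex N = true := by
        rcases h with h | h
        · exact absurd (by simpa [hasRedex] using h) h1
        · exact h
      exact Red.appR _ (red_loStep h2)
  | .sum M N, h => by
    by_cases h1 : hasRedex M = true
    · rw [loStep, if_pos h1]
      exact Red.sumL _ (red_loStep h1)
    · rw [loStep, if_neg h1]
      simp only [hasRedex, Bool.or_eq_true] at h
      have h2 : hasRedex N = true := by
        rcases h with h | h
        · exact absurd h h1
        · exact h
      exact Red.sumR _ (red_loStep h2)

/-- A `→βγ` step from a sum-free term witnesses a β-redex. [folklore] -/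
theorem hasRedex_of_red {M N : Term} (h : Red M N) (hM : M.SumFree) : M.hasRedex = true := by
  induction h with
  | beta M N => rfl
  | choiceL M N => exact hM.elim
  | choiceR M N => exact hM.elim
  | @appL M M' N hst ih =>
    have h1 := ih hM.1
    cases M with
    | var i => simp [hasRedex] at h1
    | lam P => rfl
    | app M₁ M₂ => simp [hasRedex, h1]
    | sum M₁ M₂ => exact hM.1.elim
  | @appR M N N' hst ih =>
    have h1 := ih hM.2
    cases M with
    | var i => simpa [hasRedex] using h1
    | lam P => rfl
    | app M₁ M₂ => simp [hasRedex, h1]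
    | sum M₁ M₂ => exact hM.1.elim
  | lam _ ih => exact ih hM
  | sumL N _ _ => exact hM.elim
  | sumR M _ _ => exact hM.elim

/-- **On sum-free terms, normal = no β-redex.** [folklore] -/
theorem isNormal_iff_hasRedex_false {M : Term} (hM : M.SumFree) : M.IsNormal ↔ M.hasRedex = false := by
  constructor
  · intro h
    by_contra hne
    have hr : M.hasRedex = true := by simpa using hne
    exact h _ (red_loStep hr)
  · intro h N hN
    have := hasRedex_of_red hN hM
    rw [h] at this
    exact Bool.false_ne_true this

/-- The step preserves sum-freeness. [folklore] -/
theorem SumFree.loStep {M : Term} (hM : M.SumFree) : M.loStep.SumFree := by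
  by_cases h : M.hasRedex = true
  · exact (red_loStep h).sumFree hM
  · rw [loStep_of_hasRedex_false (by simpa using h)]; exact hM

/-- Iterating the step from a sum-free term gives sum-free terms reached by reduction.
[folklore] -/
theorem reduces_iterate_loStep {M : Term} (hM : M.SumFree) (n : ℕ) :
    (loStep^[n] M).SumFree ∧ Reduces M (loStep^[n] M) := by
  induction n with
  | zero => exact ⟨hM, Relation.ReflTransGen.refl⟩
  | succ n ih =>
    rw [Function.iterate_succ_apply']
    refine ⟨ih.1.loStep, ?_⟩
    by_cases h : (loStep^[n] M).hasRedex = true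
    · exact ih.2.tail (red_loStep h)
    · rw [loStep_of_hasRedex_false (by simpa using h)]; exact ih.2

/-- Once normal, the iteration is stationary. [folklore] -/
theorem iterate_loStep_of_hasRedex_false {M : Term} (h : M.hasRedex = false) (n : ℕ) :
    loStep^[n] M = M := by
  induction n with
  | zero => rfl
  | succ n ih => rw [Function.iterate_succ_apply', ih, loStep_of_hasRedex_false h]

/-- **Clocked leftmost-outermost normalisation.** If every `→βγ`-sequence from the sum-free term
`M` has length at most `W`, then for every `T > W` the iterate `loStep^[T] M` is a normal form of
`M`. [cite: GaboardiMarionRonchidellarocca2008, Thm. 3.5] -/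
theorem loStep_clocked {M : Term} (hM : M.SumFree) {W : ℕ}
    (hbound : ∀ (f : ℕ → Term) (L : ℕ), f 0 = M → (∀ i, i < L → Red (f i) (f (i + 1))) → L ≤ W)
    {T : ℕ} (hT : W < T) :
    (loStep^[T] M).IsNormal ∧ Reduces M (loStep^[T] M) := by
  -- some iterate up to `W` has no redex, for otherwise the iterates form a sequence of length `W + 1`
  have hex : ∃ i, i ≤ W ∧ (loStep^[i] M).hasRedex = false := by
    by_contra hne
    have hall : ∀ i, i ≤ W → (loStep^[i] M).hasRedex = true := fun i hi => by
      by_contra hc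
      exact hne ⟨i, hi, by simpa using hc⟩
    have := hbound (fun i => loStep^[i] M) (W + 1) rfl fun i hi => by
      rw [Function.iterate_succ_apply']
      exact red_loStep (hall i (by omega))
    omega
  obtain ⟨i, hiW, hi⟩ := hex
  have hstat : loStep^[T] M = loStep^[i] M := by
    obtain ⟨k, rfl⟩ := Nat.exists_eq_add_of_le (show i ≤ T by omega)
    rw [Nat.add_comm, Function.iterate_add_apply, iterate_loStep_of_hasRedex_false hi]
  rw [hstat]
  obtain ⟨hsf, hred⟩ := reduces_iterate_loStep hM i
  exact ⟨(isNormal_iff_hasRedex_false hsf).2 hi, hred⟩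

/-- **Reading the answer off the clocked normal form**: under the hypotheses of
`loStep_clocked`, `M →* 0 ↔ loStep^[T] M = 0`. [cite: GaboardiMarionRonchidellarocca2008, Thm. 3.5 and Def. 3.8] -/
theorem reduces_zero_iff_loStep_clocked {M : Term} (hM : M.SumFree) {W : ℕ}
    (hbound : ∀ (f : ℕ → Term) (L : ℕ), f 0 = M → (∀ i, i < L → Red (f i) (f (i + 1))) → L ≤ W)
    {T : ℕ} (hT : W < T) : Reduces M STA.zero ↔ loStep^[T] M = STA.zero := by
  obtain ⟨hn, hred⟩ := loStep_clocked hM hbound hT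
  exact reduces_zero_iff_of_normal hM hred hn

end Term

end STA

end Literature.Computability.ImplicitComplexity
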